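import Mathlib
import HarnessLib
import Summits.Ventures.LatticeQCDFlow.Scoring.SplitChainTailsPair

/-!
# THE TOUR VARIANCE IS THE GREEN–KUBO ASYMPTOTIC VARIANCE: for a kernel minorised by its invariant
# law, `ε · E[Z_0²] = Var_π f + 2 Σ_{k≥1} C_f(k)` — the regenerative error bar and the
# integrated-autocorrelation-time error bar are the same number

HONEST FRAMING: exact (Metropolis-corrected) sampling algorithms for lattice gauge theory;
figures of merit are autocorrelation/cost numbers at stated couplings and volumes; no
continuum-physics claim.

Venture `LatticeQCDFlow` (cell pub-lqcd), topic `Scoring`; FANOUT row 8 (`s0-cpn-nemc`, GEN-16).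
NEW WORK of the cell, not a published result; no definition is introduced.  Notation of
`Scoring/SplitChainTours.lean` / `Scoring/SplitChainCycleFormula.lean`; here the minorising law IS
the invariant law (`κ(x, ·) ≥ ε π`, as for the flow / independence samplers of the cell), `f̄ = f − π(f)`,
`Z_0 = ∑' u, 1{K_u = 0} f̄(X_u)` the centred sum over the first tour of the fresh split chain, and
`C(k) = ∫ f̄ · (kop κ)^[k] f̄ dπ` the stationary autocovariance (`Scoring.autocov`).  Squaring the
tour sum pathwise (`Z_0² = ∑_u 1{K_u=0} f̄(X_u)(f̄(X_u) + 2 Σ_{t<u} f̄(X_t))` once the tour has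
ended), moving by the residual kernel between regenerations (`Scoring/SplitChainTailsPair.lean`:
`E[T_{t+d} f̄(X_t) g(X_{t+d})] = (1−ε)^{t+d} π(f̄ · R^d g)` using `π R = π`), the centred identity
`(1−ε)^d R^d f̄ = K^d f̄` (`Scoring/KernelTransitionOperator.iterate_kop_eq_of_centred`) and the
Cauchy product `Σ_u Σ_{t<u} (1−ε)^t C(u−t) = (Σ_j (1−ε)^j)(Σ_{k≥1} C(k))` give
`ε · E[Z_0²] = π(f̄²) + 2 Σ_{k≥1} C(k)`: THE SECOND MOMENT OF A TOUR SUM, TIMES THE REGENERATION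
RATE, IS THE ASYMPTOTIC VARIANCE of the time average (`Scoring/DoeblinGreenKubo.lean`,
`Scoring/VarianceOfTheMean.lean`).  Printed counterpart NAMED ONLY: the regenerative
representation of the asymptotic variance `σ² = E[Z_1²]/E[N_1]` (Nummelin 1984 §7; Meyn–Tweedie
1993 Thm 17.3.6; Mykland–Tierney–Yu 1995 eq. (4); Hobert–Jones–Presnell–Rosenthal 2002 §2) —
nothing is cited as a fact.

## Content (`e = ε.toReal`, `r = 1 − e`; `0 < ε < 1`; `π` invariant AND minorising; `|f| ≤ C`)

* **`splitChain_fresh_sq_centredTourSum_eq`** — THE IDENTITY: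
  `e · E_{P̂_π̂}[Z_0²] = ∫ f̄² dπ + 2 ∑' k, ∫ f̄ · (kop κ)^[k+1] f̄ dπ`.

Reading (value-free): the CLT-free regenerative certificates of this chapter (which use only the
crude bound `E[Z_0²] ≤ (2C)²(2 − ε)/ε²`) and the `τ_int`-based error bars of GEN-10…13 are about one
and the same number.  NOT CLAIMED: the CLT itself; `ν ≠ π`; any `ε` of ours.
-/

noncomputable section

namespace Summit.Ventures.LatticeQCDFlow.Scoring

open MeasureTheory ProbabilityTheory Filter Finset Preorder Literature.Probability.MarkovChains
open scoped ENNReal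

section Variance

variable {Ω : Type*} [MeasurableSpace Ω]
  {κ : Kernel Ω Ω} [IsMarkovKernel κ] {π : Measure Ω} [IsProbabilityMeasure π] {ε : ℝ≥0∞}
  {hmin : ∀ x {B : Set Ω}, MeasurableSet B → ε * π B ≤ κ x B}
  (κs : Kernel (Ω × Bool) (Ω × Bool)) [IsMarkovKernel κs]

/-- **THE TOUR VARIANCE IS THE ASYMPTOTIC VARIANCE.**  `π` invariant with `κ(x, ·) ≥ ε π`,
`0 < ε < 1`, `|f| ≤ C` measurable, `f̄ = f − π(f)`, `Z_0 = ∑' u, 1{K_u = 0} f̄(X_u)` the centred sum over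
the first tour of the fresh split chain from `π ⊗ δ_true`.  Then
`e · E[Z_0²] = ∫ f̄² dπ + 2 ∑' k, ∫ f̄ · (kop κ)^[k+1] f̄ dπ` (`= Var_π f + 2 Σ_{k≥1} C_f(k)`). -/
theorem splitChain_fresh_sq_centredTourSum_eq (hπ : Kernel.Invariant κ π) (hε0 : 0 < ε) (hε : ε < 1)
    (hκs : ∀ p, κs p = (ε • π).map (fun y : Ω => (y, true))
      + ((1 - ε) • Doeblin.residualKernel κ π ε hmin p.1).map (fun y : Ω => (y, false)))
    {f : Ω → ℝ} (hf : Measurable f) {C : ℝ} (hC : ∀ x, |f x| ≤ C) :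
    ε.toReal * ∫ x, (∑' u, (if (∑ s ∈ Finset.range u, (if (x (s + 1)).2 then (1 : ℕ) else 0)) = 0
        then (1 : ℝ) else 0) * (f (x u).1 - ∫ z, f z ∂π)) ^ 2
        ∂(Kernel.trajMeasure (X := fun _ : ℕ => Ω × Bool) (π.map (fun y : Ω => (y, true)))
          (fun n : ℕ => κs.comap (fun h : (i : ↥(Finset.Iic n)) → Ω × Bool =>
            h ⟨n, Finset.mem_Iic.2 le_rfl⟩) (measurable_pi_apply _)))
      = (∫ y, (f y - ∫ z, f z ∂π) ^ 2 ∂π)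
        + 2 * ∑' k, ∫ y, (f y - ∫ z, f z ∂π)
          * (kop κ)^[k + 1] (fun y => f y - ∫ z, f z ∂π) y ∂π := by
  haveI hπt : IsProbabilityMeasure (π.map (fun y : Ω => (y, true))) :=
    Measure.isProbabilityMeasure_map (measurable_tagCoin true).aemeasurable
  haveI := Doeblin.isMarkovKernel_residualKernel (κ := κ) (ν := π) (hmin := hmin) hε
  set P := Kernel.trajMeasure (X := fun _ : ℕ => Ω × Bool) (π.map (fun y : Ω => (y, true)))
      (fun n : ℕ => κs.comap (fun h : (i : ↥(Finset.Iic n)) → Ω × Bool =>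
        h ⟨n, Finset.mem_Iic.2 le_rfl⟩) (measurable_pi_apply _)) with hP
  set c := ∫ z, f z ∂π with hc
  set fb : Ω → ℝ := fun y => f y - c with hfbdef
  set r : ℝ := 1 - ε.toReal with hrdef
  have he0 : 0 < ε.toReal := ENNReal.toReal_pos hε0.ne' (ne_top_of_lt hε)
  have he1 : ε.toReal ≤ 1 := by
    have := (ENNReal.toReal_lt_toReal (ne_top_of_lt hε) ENNReal.one_ne_top).2 hε
    rw [ENNReal.toReal_one] at this; exact this.le
  have hr0 : 0 ≤ r := by rw [hrdef]; linarith
  have hr1 : r < 1 := by rw [hrdef]; linarith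
  have hrnorm : ‖r‖ < 1 := by rw [Real.norm_eq_abs, abs_of_nonneg hr0]; exact hr1
  have hr' : (1 - ε).toReal = r := by
    rw [hrdef, ENNReal.toReal_sub_of_le hε.le ENNReal.one_ne_top, ENNReal.toReal_one]
  -- the centred observable
  have hcC : |c| ≤ C := by
    calc |c| = ‖∫ z, f z ∂π‖ := (Real.norm_eq_abs _).symm
      _ ≤ C * π.real Set.univ := norm_integral_le_of_norm_le_const (Eventually.of_forall fun y => by
          rw [Real.norm_eq_abs]; exact hC y)
      _ = C := by rw [probReal_univ, mul_one]
  have hfb : Measurable fb := hf.sub_const c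
  have hCfb : ∀ y, |fb y| ≤ 2 * C := fun y => by
    calc |f y - c| ≤ |f y| + |c| := abs_sub _ _
      _ ≤ C + C := add_le_add (hC y) hcC
      _ = 2 * C := by ring
  have hC0 : 0 ≤ C := (abs_nonneg _).trans (hC (Classical.choice (nonempty_of_isProbabilityMeasure π)))
  have hfb0 : ∫ y, fb y ∂π = 0 := by
    show ∫ y, f y - c ∂π = 0
    rw [integral_sub (integrable_of_bounded π hf hC) (integrable_const c), integral_const,
      probReal_univ, one_smul, hc, sub_self]
  -- autocovariances `Cₖ`
  have hCk : ∀ k, |∫ y, fb y * (kop κ)^[k] fb y ∂π| ≤ (2 * C) ^ 2 * r ^ k := fun k =>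
    abs_autocov_le_of_centred (κ := κ) hπ hmin hε hfb hCfb hfb0 k
  have hcentred : ∀ d, ∫ y, fb y * (kop κ)^[d] fb y ∂π
      = r ^ d * ∫ y, fb y * (kop (Doeblin.residualKernel κ π ε hmin))^[d] fb y ∂π := by
    intro d
    rw [iterate_kop_eq_of_centred (κ := κ) (π := π) (hmin := hmin) hπ hε hfb hCfb hfb0 d, hr',
      ← integral_const_mul]
    exact integral_congr_ae (ae_of_all _ fun y => by ring)
  -- (2) the moments of the series terms
  have hG : ∀ u : ℕ, ∫ x, (∏ i ∈ Finset.range u, (if (x (i + 1)).2 then (0 : ℝ) else 1))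
      * (fb (x u).1 * (fb (x u).1 + 2 * ∑ t ∈ Finset.range u, fb (x t).1)) ∂P
      = r ^ u * ∫ y, fb y ^ 2 ∂π
        + 2 * ∑ t ∈ Finset.range u, r ^ t * ∫ y, fb y * (kop κ)^[u - t] fb y ∂π := by
    intro u
    -- diagonal term
    have hdiag := splitChain_fresh_tailsPair κs (κ := κ) (π := π) (hmin := hmin) hπ hε hκs hfb hfb
      hCfb hCfb u 0
    simp only [Nat.add_zero, Function.iterate_zero, id] at hdiag
    rw [← hP] at hdiag
    -- off-diagonal terms
    have hoff : ∀ t ∈ Finset.range u, ∫ x, (∏ i ∈ Finset.range u,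
        (if (x (i + 1)).2 then (0 : ℝ) else 1)) * fb (x t).1 * fb (x u).1 ∂P
        = r ^ t * ∫ y, fb y * (kop κ)^[u - t] fb y ∂π := by
      intro t ht
      have htu : t + (u - t) = u := by have := Finset.mem_range.1 ht; omega
      have h := splitChain_fresh_tailsPair κs (κ := κ) (π := π) (hmin := hmin) hπ hε hκs hfb hfb
        hCfb hCfb t (u - t)
      rw [htu, ← hP] at h
      rw [h, hcentred (u - t), ← mul_assoc, ← pow_add, htu]
    -- integrability of the pieces
    have hTm := measurable_tailsProd₀ (Ω := Ω) u
    have hfbu : ∀ v : ℕ, Measurable fun x : ℕ → Ω × Bool => fb (x v).1 := fun v =>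
      hfb.comp (measurable_fst.comp (measurable_pi_apply v))
    have hI1 : Integrable (fun x : ℕ → Ω × Bool => (∏ i ∈ Finset.range u,
        (if (x (i + 1)).2 then (0 : ℝ) else 1)) * fb (x u).1 * fb (x u).1) P := by
      refine integrable_of_bounded P ((hTm.mul (hfbu u)).mul (hfbu u)) (C := 1 * (2 * C) * (2 * C))
        fun x => ?_
      rw [abs_mul, abs_mul, abs_of_nonneg (tailsProd₀_mem u x).1]
      exact mul_le_mul (mul_le_mul (tailsProd₀_mem u x).2 (hCfb _) (abs_nonneg _) zero_le_one)
        (hCfb _) (abs_nonneg _) (by positivity)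
    have hI2 : ∀ t ∈ Finset.range u, Integrable (fun x : ℕ → Ω × Bool => (∏ i ∈ Finset.range u,
        (if (x (i + 1)).2 then (0 : ℝ) else 1)) * fb (x t).1 * fb (x u).1) P := by
      intro t _
      refine integrable_of_bounded P ((hTm.mul (hfbu t)).mul (hfbu u)) (C := 1 * (2 * C) * (2 * C))
        fun x => ?_
      rw [abs_mul, abs_mul, abs_of_nonneg (tailsProd₀_mem u x).1]
      exact mul_le_mul (mul_le_mul (tailsProd₀_mem u x).2 (hCfb _) (abs_nonneg _) zero_le_one)
        (hCfb _) (abs_nonneg _) (by positivity)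
    have hsplit : ∀ x : ℕ → Ω × Bool, (∏ i ∈ Finset.range u, (if (x (i + 1)).2 then (0 : ℝ) else 1))
        * (fb (x u).1 * (fb (x u).1 + 2 * ∑ t ∈ Finset.range u, fb (x t).1))
        = (∏ i ∈ Finset.range u, (if (x (i + 1)).2 then (0 : ℝ) else 1)) * fb (x u).1 * fb (x u).1
          + 2 * ∑ t ∈ Finset.range u, (∏ i ∈ Finset.range u,
            (if (x (i + 1)).2 then (0 : ℝ) else 1)) * fb (x t).1 * fb (x u).1 := by
      intro x
      set T := ∏ i ∈ Finset.range u, (if (x (i + 1)).2 then (0 : ℝ) else 1) with hT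
      calc T * (fb (x u).1 * (fb (x u).1 + 2 * ∑ t ∈ Finset.range u, fb (x t).1))
          = T * fb (x u).1 * fb (x u).1
            + 2 * ((T * fb (x u).1) * ∑ t ∈ Finset.range u, fb (x t).1) := by ring
        _ = T * fb (x u).1 * fb (x u).1
            + 2 * ∑ t ∈ Finset.range u, (T * fb (x u).1) * fb (x t).1 := by rw [Finset.mul_sum]
        _ = _ := by
            congr 1
            congr 1
            exact Finset.sum_congr rfl fun t _ => by ring
    simp_rw [hsplit]
    rw [integral_add hI1 ((integrable_finsetSum _ hI2).const_mul 2), integral_const_mul,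
      integral_finsetSum _ hI2, hdiag, Finset.sum_congr rfl hoff, ← hrdef]
    congr 1
    congr 1
    exact integral_congr_ae (ae_of_all _ fun y => by simp only [sq])
  -- the indicator form of (2)
  have hG' : ∀ u : ℕ, ∫ x, (if (∑ s ∈ Finset.range u, (if (x (s + 1)).2 then (1 : ℕ) else 0)) = 0
      then (1 : ℝ) else 0) * (fb (x u).1 * (fb (x u).1 + 2 * ∑ t ∈ Finset.range u, fb (x t).1)) ∂P
      = r ^ u * ∫ y, fb y ^ 2 ∂π
        + 2 * ∑ t ∈ Finset.range u, r ^ t * ∫ y, fb y * (kop κ)^[u - t] fb y ∂π := fun u => by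
    simp_rw [headCount_eq_zero_indicator]; exact hG u
  -- (3) integrability of the series terms and summability of their norms
  have hfbu : ∀ v : ℕ, Measurable fun x : ℕ → Ω × Bool => fb (x v).1 := fun v =>
    hfb.comp (measurable_fst.comp (measurable_pi_apply v))
  have hGm : ∀ u : ℕ, Measurable fun x : ℕ → Ω × Bool => (if (∑ s ∈ Finset.range u,
      (if (x (s + 1)).2 then (1 : ℕ) else 0)) = 0 then (1 : ℝ) else 0)
      * (fb (x u).1 * (fb (x u).1 + 2 * ∑ t ∈ Finset.range u, fb (x t).1)) := fun u =>
    (measurable_headCountIndicator u 0).mul ((hfbu u).mul ((hfbu u).add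
      ((Finset.measurable_sum _ fun t _ => hfbu t).const_mul 2)))
  have hGbd : ∀ (u : ℕ) (x : ℕ → Ω × Bool), |(if (∑ s ∈ Finset.range u,
      (if (x (s + 1)).2 then (1 : ℕ) else 0)) = 0 then (1 : ℝ) else 0)
      * (fb (x u).1 * (fb (x u).1 + 2 * ∑ t ∈ Finset.range u, fb (x t).1))|
      ≤ (2 * C) ^ 2 * (2 * (u : ℝ) + 1) * (if (∑ s ∈ Finset.range u,
        (if (x (s + 1)).2 then (1 : ℕ) else 0)) = 0 then (1 : ℝ) else 0) := by
    intro u x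
    have hind : 0 ≤ (if (∑ s ∈ Finset.range u, (if (x (s + 1)).2 then (1 : ℕ) else 0)) = 0
        then (1 : ℝ) else 0) := by split_ifs <;> norm_num
    have hsum : |∑ t ∈ Finset.range u, fb (x t).1| ≤ u * (2 * C) := by
      calc |∑ t ∈ Finset.range u, fb (x t).1| ≤ ∑ t ∈ Finset.range u, |fb (x t).1| :=
            Finset.abs_sum_le_sum_abs _ _
        _ ≤ ∑ _t ∈ Finset.range u, 2 * C := Finset.sum_le_sum fun t _ => hCfb _
        _ = u * (2 * C) := by rw [Finset.sum_const, Finset.card_range, nsmul_eq_mul]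
    have h2 : |fb (x u).1 + 2 * ∑ t ∈ Finset.range u, fb (x t).1| ≤ 2 * C + 2 * (u * (2 * C)) := by
      calc _ ≤ |fb (x u).1| + |2 * ∑ t ∈ Finset.range u, fb (x t).1| := abs_add_le _ _
        _ ≤ 2 * C + 2 * (u * (2 * C)) := by
            rw [abs_mul, abs_two]; exact add_le_add (hCfb _) (mul_le_mul_of_nonneg_left hsum zero_le_two)
    rw [abs_mul, abs_of_nonneg hind, mul_comm]
    refine mul_le_mul_of_nonneg_right ?_ hind
    rw [abs_mul]
    calc |fb (x u).1| * |fb (x u).1 + 2 * ∑ t ∈ Finset.range u, fb (x t).1|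
        ≤ (2 * C) * (2 * C + 2 * (u * (2 * C))) := mul_le_mul (hCfb _) h2 (abs_nonneg _) (by positivity)
      _ = (2 * C) ^ 2 * (2 * (u : ℝ) + 1) := by ring
  have hTint : ∀ u : ℕ, ∫ x, (if (∑ s ∈ Finset.range u, (if (x (s + 1)).2 then (1 : ℕ) else 0)) = 0
      then (1 : ℝ) else 0) ∂P = r ^ u := fun u => by
    simp_rw [headCount_eq_zero_indicator]
    rw [hP]; exact splitChain_fresh_tailsRun κs (κ := κ) (ν := π) (hmin := hmin) hε hκs u
  have hGint : ∀ u : ℕ, Integrable (fun x : ℕ → Ω × Bool => (if (∑ s ∈ Finset.range u,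
      (if (x (s + 1)).2 then (1 : ℕ) else 0)) = 0 then (1 : ℝ) else 0)
      * (fb (x u).1 * (fb (x u).1 + 2 * ∑ t ∈ Finset.range u, fb (x t).1))) P := fun u =>
    integrable_of_bounded P (hGm u) (C := (2 * C) ^ 2 * (2 * (u : ℝ) + 1) * 1) fun x =>
      (hGbd u x).trans (mul_le_mul_of_nonneg_left (by split_ifs <;> norm_num) (by positivity))
  have hnorm : ∀ u : ℕ, ∫ x, ‖(if (∑ s ∈ Finset.range u, (if (x (s + 1)).2 then (1 : ℕ) else 0)) = 0
      then (1 : ℝ) else 0) * (fb (x u).1 * (fb (x u).1 + 2 * ∑ t ∈ Finset.range u, fb (x t).1))‖ ∂P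
      ≤ (2 * C) ^ 2 * (2 * (u : ℝ) + 1) * r ^ u := by
    intro u
    rw [← hTint u, ← integral_const_mul]
    refine integral_mono (hGint u).norm ((integrable_of_bounded P (measurable_headCountIndicator u 0)
      (C := 1) fun x => by split_ifs <;> simp).const_mul _) fun x => ?_
    rw [Real.norm_eq_abs]
    exact hGbd u x
  have hS1 : HasSum (fun u : ℕ => (u : ℝ) * r ^ u) (r / (1 - r) ^ 2) :=
    hasSum_coe_mul_geometric_of_norm_lt_one hrnorm
  have hS2 : HasSum (fun u : ℕ => r ^ u) (1 - r)⁻¹ := hasSum_geometric_of_lt_one hr0 hr1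
  have hSmaj : Summable fun u : ℕ => (2 * C) ^ 2 * (2 * (u : ℝ) + 1) * r ^ u := by
    have h := ((hS1.mul_left 2).add hS2).mul_left ((2 * C) ^ 2)
    refine h.summable.congr fun u => ?_
    ring
  have hsumG : Summable fun u : ℕ => ∫ x, ‖(if (∑ s ∈ Finset.range u,
      (if (x (s + 1)).2 then (1 : ℕ) else 0)) = 0 then (1 : ℝ) else 0)
      * (fb (x u).1 * (fb (x u).1 + 2 * ∑ t ∈ Finset.range u, fb (x t).1))‖ ∂P :=
    Summable.of_nonneg_of_le (fun u => integral_nonneg fun x => norm_nonneg _) hnorm hSmaj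
  -- (1) almost surely `Z_0² = ∑' G_u`
  have hae : ∀ᵐ x ∂P, (∑' u, (if (∑ s ∈ Finset.range u, (if (x (s + 1)).2 then (1 : ℕ) else 0)) = 0
      then (1 : ℝ) else 0) * (f (x u).1 - c)) ^ 2
      = ∑' u, (if (∑ s ∈ Finset.range u, (if (x (s + 1)).2 then (1 : ℕ) else 0)) = 0
        then (1 : ℝ) else 0) * (fb (x u).1 * (fb (x u).1 + 2 * ∑ t ∈ Finset.range u, fb (x t).1)) := by
    have h := splitChain_ae_tourStart κs (π.map (fun y : Ω => (y, true))) (κ := κ) (ν := π)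
      (hmin := hmin) hε0 hε hκs
    rw [← hP] at h
    filter_upwards [h] with x hx
    obtain ⟨t₀, ht₀, hh₀⟩ := hx 0
    exact sq_tourSum_zero_eq_tsum fb x ht₀ hh₀
  -- (4) the geometric and Cauchy-product sums
  have he : 1 - r = ε.toReal := by rw [hrdef]; ring
  have hgeo : ∑' u : ℕ, r ^ u = 1 / ε.toReal := by rw [hS2.tsum_eq, he, one_div]
  have hb : Summable fun j : ℕ => ‖∫ y, fb y * (kop κ)^[j + 1] fb y ∂π‖ := by
    refine Summable.of_nonneg_of_le (fun j => norm_nonneg _) (fun j => ?_)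
      ((hS2.summable.mul_left ((2 * C) ^ 2 * r)))
    rw [Real.norm_eq_abs]
    calc _ ≤ (2 * C) ^ 2 * r ^ (j + 1) := hCk (j + 1)
      _ = (2 * C) ^ 2 * r * r ^ j := by ring
  have ha : Summable fun k : ℕ => ‖r ^ k‖ := by
    simp_rw [Real.norm_eq_abs, abs_of_nonneg (pow_nonneg hr0 _)]; exact hS2.summable
  have hD : ∀ n : ℕ, ∑ t ∈ Finset.range (n + 1), r ^ t * ∫ y, fb y * (kop κ)^[n + 1 - t] fb y ∂π
      = ∑ k ∈ Finset.range (n + 1), r ^ k * ∫ y, fb y * (kop κ)^[n - k + 1] fb y ∂π := fun n =>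
    Finset.sum_congr rfl fun k hk => by
      rw [show n + 1 - k = n - k + 1 by have := Finset.mem_range.1 hk; omega]
  have hDbd : ∀ u : ℕ, |∑ t ∈ Finset.range u, r ^ t * ∫ y, fb y * (kop κ)^[u - t] fb y ∂π|
      ≤ (2 * C) ^ 2 * (2 * (u : ℝ) + 1) * r ^ u := by
    intro u
    calc _ ≤ ∑ t ∈ Finset.range u, |r ^ t * ∫ y, fb y * (kop κ)^[u - t] fb y ∂π| :=
          Finset.abs_sum_le_sum_abs _ _
      _ ≤ ∑ _t ∈ Finset.range u, (2 * C) ^ 2 * r ^ u := Finset.sum_le_sum fun t ht => by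
          rw [abs_mul, abs_of_nonneg (pow_nonneg hr0 t)]
          calc r ^ t * |∫ y, fb y * (kop κ)^[u - t] fb y ∂π| ≤ r ^ t * ((2 * C) ^ 2 * r ^ (u - t)) :=
                mul_le_mul_of_nonneg_left (hCk _) (pow_nonneg hr0 t)
            _ = (2 * C) ^ 2 * r ^ (t + (u - t)) := by rw [pow_add]; ring
            _ = (2 * C) ^ 2 * r ^ u := by rw [show t + (u - t) = u by have := Finset.mem_range.1 ht; omega]
      _ = u * ((2 * C) ^ 2 * r ^ u) := by rw [Finset.sum_const, Finset.card_range, nsmul_eq_mul]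
      _ ≤ (2 * C) ^ 2 * (2 * (u : ℝ) + 1) * r ^ u := by
          have : 0 ≤ (2 * C) ^ 2 * r ^ u := by positivity
          nlinarith
  have hDsum : Summable fun u : ℕ => ∑ t ∈ Finset.range u,
      r ^ t * ∫ y, fb y * (kop κ)^[u - t] fb y ∂π :=
    Summable.of_norm_bounded hSmaj fun u => by rw [Real.norm_eq_abs]; exact hDbd u
  have hcauchy : ∑' u : ℕ, ∑ t ∈ Finset.range u, r ^ t * ∫ y, fb y * (kop κ)^[u - t] fb y ∂π
      = (1 / ε.toReal) * ∑' j : ℕ, ∫ y, fb y * (kop κ)^[j + 1] fb y ∂π := by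
    rw [← hDsum.sum_add_tsum_nat_add 1, Finset.sum_range_one, Finset.range_zero, Finset.sum_empty,
      zero_add]
    simp_rw [hD]
    rw [← tsum_mul_tsum_eq_tsum_sum_range_of_summable_norm ha hb, hgeo]
  -- (5) assemble
  have hint : ∫ x, (∑' u, (if (∑ s ∈ Finset.range u, (if (x (s + 1)).2 then (1 : ℕ) else 0)) = 0
      then (1 : ℝ) else 0) * (f (x u).1 - c)) ^ 2 ∂P
      = (1 / ε.toReal) * ∫ y, fb y ^ 2 ∂π
        + 2 * ((1 / ε.toReal) * ∑' j : ℕ, ∫ y, fb y * (kop κ)^[j + 1] fb y ∂π) := by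
    rw [integral_congr_ae hae, ← integral_tsum_of_summable_integral_norm hGint hsumG]
    simp_rw [hG']
    rw [Summable.tsum_add (hS2.summable.mul_right _) (hDsum.mul_left 2), tsum_mul_right, tsum_mul_left,
      hgeo, hcauchy]
  rw [hint]
  field_simp
  rfl

end Variance

end Summit.Ventures.LatticeQCDFlow.Scoring

end
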